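import Literature.Analysis.FluidPDE.SereginSverakAxisymmetric
import HarnessLib

/-!
# Seregin–Šverák 2009, §4: the inputs of the blow-up step, and the blow-up alternative under Type I

G. Seregin, V. Šverák, *On Type I singularities of the local axi-symmetric solutions of the
Navier–Stokes equations*, Comm. PDE 34 (2009), 171–201 = arXiv:0804.1803 (page and label
references are to the arXiv version; the text is reproduced verbatim in G. Seregin, *Lecture
notes on regularity theory for the Navier–Stokes equations* (2014), §6.5, pp. 122–125).
Companion of `Literature.Analysis.FluidPDE.SereginSverakAxisymmetric`, which vendors the
vocabulary of §3 (`parCyl`, `energyA`, `dissipationE`, `cubicC`, `pressureD`,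
`IsAxisymmetricLocalSolution`, `IsRegularAtOrigin`, `IsTypeIOnCyl`, `IsBoundedAwayFromZero`), the
named facts `ScaledEnergyBound` (Lemma 3.5), `AxisDecayBound` (Prop. 3.7), `BlowupAlternative`
(§4) and the assembly `isRegularAtOrigin_of_typeI` of Thm. 3.1.

## Why this file

The printed §4 (arXiv p. 11) runs: (i) "Using Lemmata 3.3, 3.5, 3.6, Remark 3.4, Proposition 3.7
and scaling arguments, we may assume (p1) `sup_{0<r≤1} (A+E+C+D)(0,r) = A₁ < ∞`, (p2)
`sup_Q |x'||v| = A₂ < ∞`. We may also assume that the function `v` is Hölder continuous in the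
completion of the set `𝒞 × ]-1,-a²[` for any `0 < a < 1`"; (ii) running maxima
`h(t_k) = H(t_k) = M_k = |v(x_k,t_k)| → ∞`; (iii) the axis-centred rescaling
`u^k(y,s) = λ_k v(λ_k y', x_{3k} + λ_k y₃, t_k + λ_k² s)`, `λ_k = 1/M_k`, with (p3)
`|u^k(y'_k,0,0)| = 1`, `|y'_k| ≤ A₂`, (p4) `y'_k → y'_*`, (p5) `sup |u^k| = 1`; (iv) (p6)–(p11):
weak limits, the heat equation with `F^k = u^k ⊗ u^k + p^k 𝕀`, `‖F^k‖_{3/2,Q(4a)} ≤ c₁(a)`,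
`‖∇u^k‖_{3/2,Q(3a)} ≤ c₂(a)` [LSU], the local regularity theory of the Stokes system [S8]
bootstrapped in mixed norms up to `W^{2,1}_{6,3/2}(Q(a))`, a uniform parabolic
`C^{1/2}(Q̄(a/2))` bound, `u^k → u` in `C^{1/4}(Q̄(a/2))`, whence `(u,p)` solves Navier–Stokes
in `ℝ³ × ]-∞,0[`, (p11) `|u(y'_*,0,0)| = 1`, and "`u` is the so-called bounded ancient solution
… axially symmetric and satisfies the decay estimate (p10)".

Two observations drive the rendering below.

* Step (iv) consumes the bound on `‖p^k‖_{L^{3/2}(Q(4a))} = (4a)² D((x_{3k}e₃, t_k), 4aλ_k; q)`,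
  i.e. the pressure functional at the MOVING blow-up centres `(x_{3k} e₃, t_k)` on the axis
  (`x_{3k}` need not tend to `0`, and `t_k < 0`), whereas (p1) as printed — and as transcribed in
  `BlowupAlternative` — is centred at the origin only. The printed "(p1) + scaling arguments"
  thus silently uses Lemma 3.5 / 3.6 at all axis centres `z_b = (b e₃, 0)` (and, for
  Thm. 3.2, the uniformity of their constant under time shifts). `BlowupAlternative` is a true
  statement (its hypotheses contain those of Thm. 3.2 after a zoom), but it is not provable as
  "the blow-up step": its discharge is the whole of Thm. 3.2. Under the Type I hypothesis (r3)
  of Thm. 3.1 the printed output of Lemma 3.5 (all `z_b = (b e₃, 0)`, `|b| ≤ 1/4`, `r < 1/4`)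
  does suffice: `Q((x_{3k}e₃, t_k), aλ_k) ⊆ Q((x_{3k}e₃, 0), r')` with `r'² = (aλ_k)² + |t_k|`,
  and `|t_k| M_k² ≤ C²` by (r3) at `z_k`, so `r'/(aλ_k) ≤ √(1 + C²/a²)` — an `a`-dependent
  constant, which is all step (iv) needs (`c₁(a)`). This is the corrected blow-up alternative
  `BlowupAlternativeTypeI` below (same cite, new name; same conclusion as `BlowupAlternative`),
  with which Thm. 3.1 is re-assembled (`isRegularAtOrigin_of_typeI'`).
* The two analytic inputs of §4 that are not in Mathlib are vendored as named facts, stated as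
  the printed argument uses them: `InteriorContinuity` (the sentence "we may also assume that
  `v` is Hölder continuous …", i.e. interior continuity of an essentially bounded distributional
  solution with `L^{3/2}` pressure — App. II (a21)–(a22) and §2, p. 8, resting on [S8], [LSU],
  [ESS4], [LS], [NRS]) and `BlowupCompactness` (step (iv), (p5)–(p11) with the estimates
  (p12)ff). The selection (ii)–(iii) and the bookkeeping that feeds `BlowupCompactness` are
  elementary and are proved from these two facts in the companion proofs file
  (`blowupAlternativeTypeI_of_facts`, planned), not assumed.

## Rendering choices

* `InteriorContinuity` concludes continuity on the OPEN cylinder `Q` only (the printed sentence,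
  stated after the authors' zoom, has Hölder continuity on closed sub-cylinders; interior
  continuity is weaker and is what the selection step uses), in the form "`u` agrees a.e. on `Q`
  with a function continuous on `Q`" (the standing assumptions only see the `L³` class of `u`).
* `BlowupCompactness` is stated for sequences on the cylinders `Q(R_k) = 𝒞(R_k) × ]-R_k², 0[`,
  `R_k → ∞` (the printed `Q(M_k)`), with: the distributional equations (accepted
  `IsDistributionalNSSolutionOn`, `ν = 1`, no force); the bound (p5) `|u^k| ≤ 1` a.e.; pointwise
  axisymmetry of the slices (as in `IsAxisymmetricLocalSolution`); (p2) in the a.e. form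
  `|y'| ‖u^k‖ ≤ A₂`; the pressure bound `∫_{Q(a)} |p^k|^{3/2} ≤ c(a)` for all large `k`, for each
  `a > 0` (the content of "`‖F^k‖_{3/2,Q(4a)} ≤ c₁(a)`" given (p5)); and (p3)–(p4) through a
  representative `V_k` continuous on the half-closed cylinder `𝒞(R_k) × ]-R_k², 0]` (the printed
  `u^k` is continuous there, `s = 0` corresponding to the interior time `t_k` of `Q`) with
  `m ≤ ‖V_k(0, y_k)‖`, `y_k → y_*`, for a fixed `m > 0`. In print `m = 1` (exact running maxima);
  the argument — uniform `C^{1/2}(Q̄(a/2))` bounds and uniform convergence near `(y_*, 0)` — gives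
  `|u(y_*, 0, 0)| ≥ m` verbatim, and the freedom in `m` absorbs the near-maximum selection of the
  proofs file. The conclusion is recorded, as in `BlowupAlternative`, in the a.e. forms consumed
  by `KNSS2009_liouville_bound_C_over_r`: a bounded weak solution on `ℝ³ × ]-∞, 0[` in the class
  of KNSS (= Def. 2.3 of the paper), axisymmetric, `|y'| ‖w‖ ≤ A₂`, not a.e. zero.
* `LocalHolderBound` isolates the single regularity estimate inside step (iv): the printed chain
  (p12)ff ([LSU] for `∇u^k ∈ L^{3/2}`, the local regularity theory of the Stokes system [S8]
  bootstrapped through `L_{3,3/2}`, `L_{6,3/2}`, and "the embedding theorem") ends in "sequence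
  `u^k` is uniformly bounded in the parabolic Hölder space `C^{1/2}(Q̄(a/2))`" (the 2014 reprint,
  p. 125: "uniformly bounded in a Hölder space, for example, in `C^{1/2}(Q̄(a/2))`"). It is vendored
  for ONE solution with constants uniform in the data (`|u| ≤ 1` a.e. on `Q(4a)`,
  `∫_{Q(4a)} |p|^{3/2} ≤ c`), the exponent `α > 0` being left unspecified (weaker than print; §4
  only uses equicontinuity), for the max product metric of `ℝ × ℝ³` (`HolderOnWith`). The rest of
  step (iv) — Arzelà–Ascoli, the diagonal subsequence, the passage to the limit in the
  distributional identities and (p11) — is elementary given this bound and is the subject of the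
  companion proofs files (`BlowupCompactness` from `LocalHolderBound`).
* Not here: the last sentence of §4 (KNSS 2009, Thm. 5.3), Lemma 3.6 and the Thm. 3.2 variant.

## References

* G. Seregin, V. Šverák, Comm. PDE 34 (2009) = arXiv:0804.1803: §2 p. 8 (regularity inside
  `Q₁`, [ESS4, LS, NRS]); §3 p. 9 (Thm. 3.1, Lemma 3.5); p. 10 (Prop. 3.7); §4 p. 11
  ((p1)–(p12) and the estimates following (p12)); App. II p. 14 ((a21)–(a22)). [`SereginSverak2009`]
* G. Seregin, *Lecture notes on regularity theory for the Navier–Stokes equations*, World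
  Scientific (2014), §6.5, pp. 122–125 (same text). [`Seregin2014`]
* G. Koch, N. Nadirashvili, G. Seregin, V. Šverák, Acta Math. 203 (2009), Thm. 5.3.
  [`KochNadirashviliSereginSverak2009`]
* O. A. Ladyzhenskaya, V. A. Solonnikov, N. N. Ural'tseva, *Linear and quasi-linear equations of
  parabolic type*, Transl. Math. Monogr. 23, AMS (1968) (= [LSU] of the paper).
  [`LadyzhenskayaSolonnikovUraltseva1968`]
* G. Seregin, *Local regularity theory of the Navier–Stokes equations*, Handbook of Mathematical
  Fluid Dynamics IV (2007), 159–200 (= [S8] of the paper). [`Seregin2007`]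
-/

noncomputable section

open MeasureTheory Set Function Filter Topology TopologicalSpace
open scoped NNReal ENNReal

namespace Literature.Analysis.FluidPDE

namespace SereginSverak2009

/-- Local notation for physical space `ℝ³ = EuclideanSpace ℝ (Fin 3)`. -/
local notation "ℝ³" => EuclideanSpace ℝ (Fin 3)

/-! ### The half-closed cylinders `𝒞(R) × ]-R², 0]` -/

/-- The parabolic cylinder `Q(R) = 𝒞(R) × ]-R², 0[` with its top slice `s = 0` added,
`𝒞(R) × ]-R², 0]` (time first): the set on which the rescaled fields `u^k` of §4 are continuous
and on whose top the normalisation (p3) `|u^k(y'_k, 0, 0)| = 1` is read.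
[cite: SereginSverak2009, §4 (p3) and (p11) (arXiv p. 11)] -/
def parCylTop (R : ℝ) : Set (ℝ × ℝ³) :=
  {z | z.1 ∈ Ioc (-R ^ 2) 0 ∧ z.2 ∈ spaceCyl 0 R}

/-- Membership in `𝒞(R) × ]-R², 0]`, unfolded. [cite: SereginSverak2009, §4 (arXiv p. 11)] -/
theorem mem_parCylTop {R : ℝ} {z : ℝ × ℝ³} :
    z ∈ parCylTop R ↔ z.1 ∈ Ioc (-R ^ 2) 0 ∧ z.2 ∈ spaceCyl 0 R :=
  Iff.rfl

/-- `Q(R) ⊆ 𝒞(R) × ]-R², 0]`. [folklore] -/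
theorem parCyl_zero_subset_parCylTop (R : ℝ) : parCyl 0 R ⊆ parCylTop R := by
  intro z hz
  rw [mem_parCyl] at hz
  refine ⟨⟨by simpa using hz.1.1, (show z.1 < 0 by simpa using hz.1.2).le⟩, ?_⟩
  exact (mem_spaceCyl).2 ⟨hz.2.1, hz.2.2⟩

/-- The top centre `(0, y)` lies in `𝒞(R) × ]-R², 0]` as soon as `y ∈ 𝒞(R)` and `R ≠ 0`. [folklore] -/
theorem mem_parCylTop_zero {R : ℝ} (hR : R ≠ 0) {y : ℝ³} (hy : y ∈ spaceCyl 0 R) :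
    ((0 : ℝ), y) ∈ parCylTop R :=
  ⟨⟨by simpa using pow_pos (abs_pos.2 hR) 2 |>.trans_eq (sq_abs R), le_rfl⟩, hy⟩

/-! ### The two analytic inputs of §4, as named facts -/

/-- **Seregin–Šverák 2009, §4, interior continuity under (r2)** (arXiv p. 11, first paragraph:
"We may also assume that the function `v` is Hölder continuous in the completion of the set
`𝒞 × ]-1,-a²[` for any `0 < a < 1`"; the regularity behind it is recorded in App. II,
(a21)–(a22), p. 14: "According to the local regularity theory of the Navier–Stokes equations,
see, for instance, [S8], one can easily show that the pair `v` and `q` has the following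
differentiability properties: `v ∈ W^{2,1}_{3/2}(𝒞(a) × ]-a²,-b²[)`, `q ∈ W^{1,0}_{3/2}(…)` …
for any `0 < b ≤ a < 1`", and in §2, p. 8: inside the region of essential boundedness
"`z ↦ ∇ᵏv(z)` is Hölder continuous", with proofs in [ESS4] = Escauriaza–Seregin–Šverák 2003,
[LS] = Ladyzhenskaya–Seregin 1999, [NRS] = Nečas–Růžička–Šverák 1996). Statement (interior
form): if `(u, p)` solves Navier–Stokes (`ν = 1`, no force) in the sense of distributions in
`Q = 𝒞 × ]-1, 0[` with `u ∈ L³(Q)`, `p ∈ L^{3/2}(Q)`, and `u ∈ L_∞(𝒞 × ]-1,-a²[)` for every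
`0 < a < 1` (hypothesis (r2)), then `u` agrees almost everywhere on `Q` with a function that is
continuous on the open set `Q`. (Mechanism, as in (p12)ff: on each `𝒞 × ]-1,-a²[` the heat
equation `∂ₜu - Δu = -div(u ⊗ u + p𝕀)` with right-hand side in `div L^{3/2}` gives
`∇u ∈ L^{3/2}_loc` [LSU]; the local `L_p` theory of the Stokes system with `f = -u·∇u` [S8],
iterated in mixed norms, gives `W^{2,1}_{6,3/2}` locally and parabolic Hölder continuity.)
[cite: SereginSverak2009, §4 ¶1 (arXiv p. 11) with App. II (a21)–(a22) (p. 14) and §2 (p. 8)] -/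
def InteriorContinuity : Prop :=
  ∀ (u : ℝ → ℝ³ → ℝ³) (p : ℝ → ℝ³ → ℝ),
    IsDistributionalNSSolutionOn (parCylOpens 0 1) 1 0 u p →
    (∫⁻ z in parCyl 0 1, ‖u z.1 z.2‖ₑ ^ (3 : ℕ) < ∞) →
    (∫⁻ z in parCyl 0 1, ‖p z.1 z.2‖ₑ ^ (3 / 2 : ℝ) < ∞) →
    IsBoundedAwayFromZero u →
    ∃ v : ℝ × ℝ³ → ℝ³, ContinuousOn v (parCyl 0 1) ∧
      v =ᵐ[volume.restrict (parCyl 0 1)] uncurry u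

/-- **Seregin–Šverák 2009, §4, the compactness of the blow-up sequence** (arXiv p. 11, from
(p5) to the end of §4 minus its last two sentences). Printed: the rescaled pairs `(u^k, p^k)`
"satisfy the Navier–Stokes equations in `Q(M_k)`", `M_k → ∞`; (p3) `|u^k(y'_k, 0, 0)| = 1` with
`|y'_k| ≤ A₂`, (p4) `y'_k → y'_*`; (p5) `sup |u^k| = 1`; they are axially symmetric and (by
(p2)) `|y'| |u^k(y,s)| ≤ A₂`; "we fix an arbitrary positive number `a > 0` and consider `k` so
big that `a < M_k/4`. We know that `u^k` satisfies `∂ₜu^k - Δu^k = -div F^k` in `Q(4a)`, where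
`F^k = u^k ⊗ u^k + p^k 𝕀` and `‖F^k‖_{3/2,Q(4a)} ≤ c₁(a) < ∞`. This implies, see [LSU],
`‖∇u^k‖_{3/2,Q(3a)} ≤ c₂(a)`"; then the pair solves the Stokes system (p12) with
`f^k = -u^k·∇u^k`, and "according to the local regularity theory for the Stokes system, see
[S8]", bootstrapped through `L_{3,3/2}` and `L_{6,3/2}`,
"`‖∂ₜu^k‖_{6,3/2,Q(a)} + ‖∇²u^k‖_{6,3/2,Q(a)} + ‖∇p^k‖_{6,3/2,Q(a)} ≤ c₇(a)`. By the embedding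
theorem, sequence `u^k` is uniformly bounded in the parabolic Hölder space `C^{1/2}(Q̄(a/2))`.
Hence … `u^k → u` in `C^{1/4}(Q̄(a/2))`. This means that the pair `u` and `p` obeys the
Navier–Stokes system and (p11) `|u(y'_*,0,0)| = 1` holds. So, the function `u` is the so-called
bounded ancient solution to the Navier–Stokes system which is, in addition, axially symmetric
and satisfies the decay estimate (p10) `sup |y'||u(y,s)| ≤ A₂`" (with (p6)–(p8): `u^k ⇀* u` in
`L_∞(Q(a))`, `p^k ⇀ p` in `L_{3/2}(Q(a))`, `sup |u| ≤ 1`).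

Statement. Let `R_k → ∞` and, for each `k`, let `(U k, P k)` solve Navier–Stokes (`ν = 1`, no
force) in the sense of distributions in `Q(R_k) = 𝒞(R_k) × ]-R_k², 0[`, with `‖U k‖ ≤ 1` a.e. on
`Q(R_k)` ((p5)), every slice `U k s`, `-R_k² < s < 0`, axisymmetric about the `x₃`-axis,
`|y'| ‖U k (s, y)‖ ≤ A₂` a.e. on `Q(R_k)` ((p2)), and, for every `a > 0`, `∫_{Q(a)} |P k|^{3/2} ≤ c(a)`
for all large `k` (the pressure part of "`‖F^k‖_{3/2,Q(4a)} ≤ c₁(a)`", the part not implied by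
(p5)); suppose `U k` agrees a.e. on `Q(R_k)` with a function `V_k` continuous on
`𝒞(R_k) × ]-R_k², 0]` with `m ≤ ‖V_k(0, y_k)‖`, where `y_k ∈ 𝒞(R_k)`, `y_k → y_*` and `m > 0` is
fixed ((p3)–(p4); printed with `m = 1`, see the module docstring). Then there is a bounded weak
solution `w` of Navier–Stokes on `ℝ³ × ]-∞, 0[` in the class of KNSS 2009 (= Def. 2.3 of the
paper; accepted `IsBoundedWeakNSSolutionOn (Iio 0)`), axisymmetric (for every `θ`,
`w(t, R_θ x) = R_θ w(t, x)` for a.e. `x`, for a.e. `t < 0`), with `|y'| ‖w‖ ≤ A₂` a.e. ((p10)), and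
not a.e. zero ((p11) with the continuity of the limit up to `s = 0`).
[cite: SereginSverak2009, §4 (p5)–(p12) and the estimates following (p12) (arXiv p. 11)] -/
def BlowupCompactness : Prop :=
  ∀ (U : ℕ → ℝ → ℝ³ → ℝ³) (P : ℕ → ℝ → ℝ³ → ℝ) (R : ℕ → ℝ) (y : ℕ → ℝ³) (yStar : ℝ³)
    (A₂ m : ℝ),
    Tendsto R atTop atTop → Tendsto y atTop (𝓝 yStar) → 0 < m →
    (∀ k, IsDistributionalNSSolutionOn (parCylOpens 0 (R k)) 1 0 (U k) (P k)) →
    (∀ k, ∀ᵐ z ∂(volume.restrict (parCyl 0 (R k))), ‖U k z.1 z.2‖ ≤ 1) →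
    (∀ k, ∀ s ∈ Ioo (-R k ^ 2) 0, IsAxisymmetric (U k s)) →
    (∀ k, ∀ᵐ z ∂(volume.restrict (parCyl 0 (R k))), cylRadius z.2 * ‖U k z.1 z.2‖ ≤ A₂) →
    (∀ a : ℝ, 0 < a → ∃ c : ℝ≥0, ∀ᶠ k in atTop,
      ∫⁻ z in parCyl 0 a, ‖P k z.1 z.2‖ₑ ^ (3 / 2 : ℝ) ≤ c) →
    (∀ k, ∃ V : ℝ × ℝ³ → ℝ³, ContinuousOn V (parCylTop (R k)) ∧
      V =ᵐ[volume.restrict (parCyl 0 (R k))] uncurry (U k) ∧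
      y k ∈ spaceCyl 0 (R k) ∧ m ≤ ‖V (0, y k)‖) →
    ∃ w : ℝ → ℝ³ → ℝ³, IsBoundedWeakNSSolutionOn (Iio 0) isOpen_Iio 1 w ∧
      (∀ θ : ℝ, ∀ᵐ t ∂(volume.restrict (Iio (0 : ℝ))),
        (fun x => w t (rotZ θ x)) =ᵐ[volume] fun x => rotZ θ (w t x)) ∧
      (∀ᵐ t ∂(volume.restrict (Iio (0 : ℝ))), ∀ᵐ x ∂(volume : Measure ℝ³),
        cylRadius x * ‖w t x‖ ≤ A₂) ∧
      ¬ (∀ᵐ t ∂(volume.restrict (Iio (0 : ℝ))), w t =ᵐ[volume] 0)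

/-! ### The regularity estimate inside step (iv), as a named fact -/

/-- **Seregin–Šverák 2009, §4, the uniform local Hölder bound on the blow-up sequence**
(arXiv p. 11, from "To this end, we fix an arbitrary positive number `a > 0` and consider numbers
`k` so big that `a < M_k/4`" to "By the embedding theorem, sequence `u^k` is uniformly bounded in
the parabolic Hölder space `C^{1/2}(Q̄(a/2))`"; reprinted in Seregin 2014, §6.5, p. 125, ending
"sequence `u^k` is uniformly bounded in a Hölder space, for example, in `C^{1/2}(Q̄(a/2))`").
Printed chain: `u^k` satisfies `∂ₜu^k − Δu^k = −div F^k` in `Q(4a)`, `F^k = u^k ⊗ u^k + p^k 𝕀`,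
`‖F^k‖_{3/2,Q(4a)} ≤ c₁(a) < ∞`; "this implies, see [LSU], `‖∇u^k‖_{3/2,Q(3a)} ≤ c₂(a)`"; the
pair solves the Stokes system (p12) `∂ₜu^k − Δu^k + ∇p^k = f^k`, `div u^k = 0` in `Q(3a)` with
`f^k = −u^k·∇u^k`, `‖f^k‖_{3/2,Q(3a)} ≤ c₂(a)`; "according to the local regularity theory for
the Stokes system, see [S8]", alternated with "the embedding theorem" through
`‖∇u^k‖_{3,3/2,Q(2a)} + ‖p^k‖_{3,3/2,Q(2a)} ≤ c₄(a)` and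
`‖∇u^k‖_{6,3/2,Q(2a)} + ‖p^k‖_{6,3/2,Q(2a)} ≤ c₆(a)`, one gets
`‖∂ₜu^k‖_{6,3/2,Q(a)} + ‖∇²u^k‖_{6,3/2,Q(a)} + ‖∇p^k‖_{6,3/2,Q(a)} ≤ c₇(a)` and the Hölder
bound on `Q̄(a/2)`, every constant depending only on `a` and `c₁(a)`.

Statement (for one solution, with constants uniform in the data — the content of "uniformly
bounded"): for every `a > 0` and every `c ≥ 0` there are an exponent `α > 0` and a constant `K`
such that, whenever `(u, p)` solves Navier–Stokes (`ν = 1`, no force) in the sense of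
distributions in `Q(4a) = 𝒞(4a) × ]-16a², 0[` (accepted `IsDistributionalNSSolutionOn`) with
`‖u‖ ≤ 1` a.e. on `Q(4a)` ((p5)) and `∫_{Q(4a)} |p|^{3/2} ≤ c` (whence
`‖F‖_{3/2,Q(4a)} ≤ 3|Q(4a)|^{2/3} + √3 c^{2/3} =: c₁(a)`), the field `u` agrees a.e. on `Q(a/2)`
with a function `V : ℝ × ℝ³ → ℝ³` that is `α`-Hölder continuous with constant `K` on `Q(a/2)`
for the max product metric of `ℝ × ℝ³` (Mathlib `HolderOnWith K α V (Q(a/2))`; on the bounded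
set `Q(a/2)` a parabolic `C^β(Q̄(a/2))` bound, `|V(z) − V(z')| ≤ K (|x−x'| + |t−t'|^{1/2})^β`, is
such a bound with `α = β/2`, and a Hölder function on `Q(a/2)` extends with the same constants to
`Q̄(a/2)`). The exponent is left unspecified ("for example `1/2`" in the 2014 text; the scaling
count for `W^{2,1}_{6,3/2}` alone gives `1/6`): §4 uses only `α > 0`, through equicontinuity.
[cite: SereginSverak2009, §4, (p12) and the displayed estimates following it, arXiv p. 11 (= Seregin2014 §6.5 p. 125); inputs LadyzhenskayaSolonnikovUraltseva1968 (LSU) and Seregin2007 (S8)] -/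
def LocalHolderBound : Prop :=
  ∀ a : ℝ, 0 < a → ∀ c : ℝ≥0, ∃ α K : ℝ≥0, 0 < α ∧
    ∀ (u : ℝ → ℝ³ → ℝ³) (p : ℝ → ℝ³ → ℝ),
      IsDistributionalNSSolutionOn (parCylOpens 0 (4 * a)) 1 0 u p →
      (∀ᵐ z ∂(volume.restrict (parCyl 0 (4 * a))), ‖u z.1 z.2‖ ≤ 1) →
      (∫⁻ z in parCyl 0 (4 * a), ‖p z.1 z.2‖ₑ ^ (3 / 2 : ℝ) ≤ c) →
      ∃ V : ℝ × ℝ³ → ℝ³, V =ᵐ[volume.restrict (parCyl 0 (a / 2))] uncurry u ∧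
        HolderOnWith K α V (parCyl 0 (a / 2))

/-- A Hölder bound on `Q(r)` as delivered by `LocalHolderBound` makes the representative
continuous there (Mathlib `HolderOnWith.continuousOn`). [folklore] -/
theorem continuousOn_of_holderOnWith_parCyl {K α : ℝ≥0} (hα : 0 < α) {V : ℝ × ℝ³ → ℝ³} {r : ℝ}
    (hV : HolderOnWith K α V (parCyl 0 r)) : ContinuousOn V (parCyl 0 r) :=
  hV.continuousOn hα

/-! ### The blow-up alternative under Type I -/

/-- **Seregin–Šverák 2009, §4 for Theorem 3.1: the blow-up alternative under the Type I
bound** (arXiv p. 11; corrected form of `BlowupAlternative`, same source). Hypotheses: the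
standing assumptions of §3 with axial symmetry (`IsAxisymmetricLocalSolution`), the Type I bound
(r3) of Thm. 3.1 (`IsTypeIOnCyl`), the PRINTED output of Lemma 3.5 — a weak spatial gradient
`G = ∇u` on `Q` and `A + E + C + D ≤ C₁` at all `z_b = (b e₃, 0)`, `|b| ≤ 1/4`, `0 < r < 1/4`
(the shape of `ScaledEnergyBound`) —, the output of Prop. 3.7 (`|x'| ‖u‖ ≤ C₂` a.e. on `Q(1/8)`,
the shape of `AxisDecayBound`), and "`z = 0` is a singular point". Conclusion: the blow-up limit
of §4 — a bounded weak solution on `ℝ³ × ]-∞, 0[` in the class of KNSS (Def. 2.3),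
axisymmetric, with `|y'| ‖w‖ ≤ A₂` a.e. and not a.e. zero (exactly the conclusion of
`BlowupAlternative`; the last sentence of §4, KNSS 2009 Thm. 5.3, is not part of the fact).

Discrepancy with `BlowupAlternative` (module docstring): there (p1) is hypothesised at the
centre `(0, 0)` only, as printed, and Type I is replaced by (r2); but the printed step (iv) uses
the pressure bound at the moving centres `(x_{3k} e₃, t_k)`, which the origin-centred (p1) does
not control. Here the full printed range of Lemma 3.5 (`|b| ≤ 1/4`) is kept and (r3) is kept, and
then the printed argument goes through: `Q((x_{3k}e₃,t_k), aλ_k) ⊆ Q((x_{3k}e₃,0), r')`,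
`r'² = (aλ_k)² + |t_k| ≤ (aλ_k)²(1 + C²/a²)` by (r3) at `z_k`. The reduction of this fact to
`InteriorContinuity` and `BlowupCompactness` is elementary (near-maximum selection, rescaling
covariance) and is the subject of the companion proofs file.
[cite: SereginSverak2009, §4 (proof of Thm. 3.1, (p1)–(p11), arXiv p. 11) with Lemma 3.5 and Prop. 3.7] -/
def BlowupAlternativeTypeI : Prop :=
  ∀ (u : ℝ → ℝ³ → ℝ³) (p : ℝ → ℝ³ → ℝ), IsAxisymmetricLocalSolution u p → IsTypeIOnCyl u →
    (∃ G : ℝ → ℝ³ → ℝ³ →L[ℝ] ℝ³, HasWeakSpatialGradientOn (parCylOpens 0 1) u G ∧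
      ∃ C₁ : ℝ≥0, ∀ b : ℝ, |b| ≤ 1 / 4 → ∀ r ∈ Ioo (0 : ℝ) (1 / 4),
        energyA ((0 : ℝ), b • eZ) r u + dissipationE ((0 : ℝ), b • eZ) r G +
          cubicC ((0 : ℝ), b • eZ) r u + pressureD ((0 : ℝ), b • eZ) r p ≤ C₁) →
    (∃ C₂ : ℝ, ∀ᵐ z ∂(volume.restrict (parCyl 0 (1 / 8))), cylRadius z.2 * ‖u z.1 z.2‖ ≤ C₂) →
    ¬ IsRegularAtOrigin u →
    ∃ w : ℝ → ℝ³ → ℝ³, IsBoundedWeakNSSolutionOn (Iio 0) isOpen_Iio 1 w ∧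
      (∀ θ : ℝ, ∀ᵐ t ∂(volume.restrict (Iio (0 : ℝ))),
        (fun x => w t (rotZ θ x)) =ᵐ[volume] fun x => rotZ θ (w t x)) ∧
      (∃ A₂ : ℝ, ∀ᵐ t ∂(volume.restrict (Iio (0 : ℝ))), ∀ᵐ x ∂(volume : Measure ℝ³),
        cylRadius x * ‖w t x‖ ≤ A₂) ∧
      ¬ (∀ᵐ t ∂(volume.restrict (Iio (0 : ℝ))), w t =ᵐ[volume] 0)

/-- **Seregin–Šverák 2009, Theorem 3.1, assembled as in §4 through the Type I blow-up
alternative** (arXiv p. 11): from `ScaledEnergyBound` (Lemma 3.5), `AxisDecayBound`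
(Prop. 3.7), `BlowupAlternativeTypeI` (§4) and `KNSS2009_liouville_bound_C_over_r` (KNSS 2009,
Thm. 5.3), an axially symmetric distributional solution in `Q` with `u ∈ L³(Q)`,
`p ∈ L^{3/2}(Q)` and the Type I bound (r3) is regular at the origin. Same proof as
`isRegularAtOrigin_of_typeI`, with the outputs of Lemma 3.5 and Prop. 3.7 handed over whole.
[cite: SereginSverak2009, Thm. 3.1 and §4] -/
theorem isRegularAtOrigin_of_typeI' (h35 : ScaledEnergyBound) (h37 : AxisDecayBound)
    (h4 : BlowupAlternativeTypeI) (h53 : KNSS2009_liouville_bound_C_over_r)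
    {u : ℝ → ℝ³ → ℝ³} {p : ℝ → ℝ³ → ℝ} (hsol : IsAxisymmetricLocalSolution u p)
    (hI : IsTypeIOnCyl u) : IsRegularAtOrigin u := by
  by_contra hsing
  obtain ⟨w, hw, haxi, hdecay, hne⟩ := h4 u p hsol hI (h35 u p hsol hI) (h37 u p hsol hI) hsing
  exact hne (h53 hw haxi hdecay)

end SereginSverak2009

end Literature.Analysis.FluidPDE
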